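import Summits.BirchSwinnertonDyer.Rank1Residual.O5.O5FlatKummerNormalForm
import Mathlib.NumberTheory.Padics.Hensel
import HarnessLib

/-!
# O5 — T30.6 Case S, the two EXISTENTIAL halves PROVED (sign-free): a RAMIFIED class always, a UNIT class iff `9 ∤ 3b + 3ᵃA₃`
# (cell `b2b-bsdres`, team n1011, ROW T-FLEX-KOD extension 4b; seat `b2b-bsdres-n1011-p18` GEN 14 under the idle rule;
#  TOOL theorems for the typer's re-typing of `FlexNFCaseSKummerLawThree` (refuted AS TYPED by the sign slip,
#  `FlexNFCaseSKummerLawThreeSign.lean`); theorems only; nothing of the typer's file is edited)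

HONEST FRAMING (cell `b2b-bsdres`, run/shared/lean/b2b/bsd-rank1-residual/, verbatim in every file): the
goal of the cell is to DELETE the COMBINATION-SHAPED residual classes of the Birch–Swinnerton-Dyer formula
for ALL analytic-rank `≤ 1` elliptic curves over `ℚ` — "full BSD formula for every rank `≤ 1` curve in
class `C`" assembled STRICTLY from published theorems — so that the rank-`≤ 1` remainder becomes exactly
the CONSTRUCTION-SHAPED classes, which are TYPED (missing-input `Prop`s), NOT attempted. This is not
"finishing BSD". Lane CLASS-CLOSURE / O5 (O5 OPEN): research route; census output (P-K19) is EVIDENCE,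
never a Literature fact; nothing is booked; no mark of `RESIDUAL-MAP.md` moves. This file: THEOREMS ONLY
(no definition, no named fact, no `@[conjecture]` node, no `sorry`; net named-fact debt `0`). Closes NO pair
and moves NO mark.

## What is proved (Case S: `y² + 3b·xy + 3ᵃA₃·y = x³`, `a ∈ {1, 2}`, `3 ∤ A₃`, ANY sign of `A₃`)

* `nfKummerHasRamified_S` — the FIRST conjunct of T30.6 AS TYPED, for every `(a, b, A₃)`: the point
  `(27, y)` with `y` the Hensel root of `Y² + (81b + 3ᵃA₃)Y − 3⁹` next to `y₀ = −(81b + 3ᵃA₃)` has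
  `v₃(y) = a ∉ 3ℤ` (a très ramifié tangent value; `δ` meets the line of `[3ᵃA₃]`).
* `nfKummerHasUnit_S` — a UNIT class whenever `9 ∤ 3b + 3ᵃA₃`: the point `(1, y)`, `y` the Hensel root of
  `Y² + (3b + 3ᵃA₃)Y − 1` next to `1`, is a `3`-adic unit with `ȳ² = 1 − c̄ȳ ≠ 1` in `ℤ/9` (else `9 ∣ c`), hence
  not a cube (`not_exists_pow_three_eq_of_sq_ne_one`).
* `nfKummerHasUnit_S_of_cellS` — under the planner's normalisation `A₃ ≡ 1 (mod 3)`: `(cellS a b).k = 2 ⟹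
  NFKummerHasUnit b A₃ a` (the THIRD conjunct of the repaired node `C′`; `k = 2` iff `a = 1, b ≢ 2` or
  `a = 2, b ≢ 0 (mod 3)`, exactly the residue classes with `9 ∤ 3b + 3ᵃA₃`).
NOT proved: the SECOND conjunct of `C′` (`k = 1 → NFKummerInLineOfA₃`, a statement about ALL points: o5-r1's
"`E = ⟨P₀⟩ + E⁰`, `δ(E⁰) = ⟨[y(Q₁)]⟩`" step).
[cite: CohenPazuki2009ThreeDescent, Def. 1.3 and Prop. 2.2 (arXiv:0903.4963 pp. 4–5)] [cite: SilvermanATAEC1994, IV.9.4]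
-/

noncomputable section

open Polynomial

namespace Summit.BirchSwinnertonDyer.Rank1Residual.O5.FlexNormalForm

/-- `‖n‖ = 1` in `ℤ₃` for an integer `n` prime to `3`. [folklore] -/
private theorem norm_intCast_eq_one'' {n : ℤ} (hn : ¬ (3 : ℤ) ∣ n) : ‖(n : ℤ_[3])‖ = 1 :=
  le_antisymm (PadicInt.norm_le_one _)
    (not_lt.1 fun h ↦ hn (by exact_mod_cast (PadicInt.norm_int_lt_one_iff_dvd n).1 h))

/-! ## §1 A RAMIFIED class on every Case-S curve -/

/-- **Hensel, ramified point.** For `a ∈ {1,2}`, `3 ∤ A₃`, `c := 81b + 3ᵃA₃`: `Y² + cY − 3⁹` has a root `y ∈ ℤ₃`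
with `‖y‖ = 3⁻ᵃ`. [folklore] -/
theorem exists_root_ramified (a : ℕ) (b A₃ : ℤ) (ha : a = 1 ∨ a = 2) (hA : ¬ (3 : ℤ) ∣ A₃) :
    ∃ y : ℤ_[3], y ^ 2 + ((81 * b + 3 ^ a * A₃ : ℤ) : ℤ_[3]) * y - 3 ^ 9 = 0 ∧ ‖y‖ = (3 : ℝ)⁻¹ ^ a := by
  have h3 : ‖(3 : ℤ_[3])‖ = (3 : ℝ)⁻¹ := by exact_mod_cast PadicInt.norm_p (p := 3)
  set c : ℤ_[3] := ((81 * b + 3 ^ a * A₃ : ℤ) : ℤ_[3]) with hc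
  -- `‖c‖ = 3⁻ᵃ`
  have hcn : ‖c‖ = (3 : ℝ)⁻¹ ^ a := by
    have h1 : ‖((3 ^ a * A₃ : ℤ) : ℤ_[3])‖ = (3 : ℝ)⁻¹ ^ a := by
      push_cast
      rw [norm_mul, norm_pow, h3, norm_intCast_eq_one'' hA, mul_one]
    have h2 : ‖((81 * b : ℤ) : ℤ_[3])‖ < (3 : ℝ)⁻¹ ^ a := by
      push_cast
      rw [norm_mul, show (81 : ℤ_[3]) = 3 ^ 4 by norm_num, norm_pow, h3]
      calc ((3 : ℝ)⁻¹) ^ 4 * ‖(b : ℤ_[3])‖ ≤ ((3 : ℝ)⁻¹) ^ 4 * 1 := by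
            gcongr; exact PadicInt.norm_le_one _
        _ < (3 : ℝ)⁻¹ ^ a := by rcases ha with rfl | rfl <;> norm_num
    have e : c = ((81 * b : ℤ) : ℤ_[3]) + ((3 ^ a * A₃ : ℤ) : ℤ_[3]) := by rw [hc]; push_cast; ring
    rw [e, PadicInt.norm_add_eq_max_of_ne (by rw [h1]; exact ne_of_lt h2), h1, max_eq_right h2.le]
  let G : ℤ_[3][X] := X ^ 2 + C c * X - C (3 ^ 9)
  have hG : ∀ t : ℤ_[3], aeval t G = t ^ 2 + c * t - 3 ^ 9 := fun t ↦ by simp [G]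
  have hG' : ∀ t : ℤ_[3], aeval t (derivative G) = 2 * t + c := fun t ↦ by
    simp [G, derivative_mul, derivative_pow, derivative_C]
    try ring
    try norm_num
    try simp
  have hn1 : ‖aeval (-c) (derivative G)‖ = (3 : ℝ)⁻¹ ^ a := by
    rw [hG', show (2 : ℤ_[3]) * -c + c = -c by ring, norm_neg, hcn]
  have hn0 : ‖aeval (-c) G‖ = (3 : ℝ)⁻¹ ^ 9 := by
    rw [hG, show (-c) ^ 2 + c * -c - (3 : ℤ_[3]) ^ 9 = -(3 ^ 9) by ring, norm_neg, norm_pow, h3]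
  have hnorm : ‖aeval (-c) G‖ < ‖aeval (-c) (derivative G)‖ ^ 2 := by
    rw [hn0, hn1, ← pow_mul]
    have : a * 2 < 9 := by rcases ha with rfl | rfl <;> norm_num
    exact pow_lt_pow_right_of_lt_one₀ (by norm_num) (by norm_num) this
  obtain ⟨y, hy, hy1, -, -⟩ := hensels_lemma hnorm
  refine ⟨y, by rw [← hG]; exact hy, ?_⟩
  -- `‖y‖ = ‖-c‖` since `‖y - (-c)‖ < ‖-c‖`
  rw [hn1] at hy1
  have hcn' : ‖-c‖ = (3 : ℝ)⁻¹ ^ a := by rw [norm_neg, hcn]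
  have e : y = (y - -c) + -c := by ring
  rw [e, PadicInt.norm_add_eq_max_of_ne (by rw [hcn']; exact ne_of_lt hy1), hcn', max_eq_right hy1.le]

/-- **T30.6, FIRST conjunct, AS TYPED: a RAMIFIED class on every Case-S flex normal form.**  For `a ∈ {1, 2}`,
`3 ∤ A₃`: `NFKummerHasRamified b A₃ a` — the point `(27, y)`, `v₃(y) = a`. [cite: SilvermanATAEC1994, IV.9.4] -/
theorem nfKummerHasRamified_S (a : ℕ) (b A₃ : ℤ) (ha : a = 1 ∨ a = 2) (hA : ¬ (3 : ℤ) ∣ A₃) :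
    NFKummerHasRamified b A₃ a := by
  obtain ⟨y, hy, hyn⟩ := exists_root_ramified a b A₃ ha hA
  have hy0 : y ≠ 0 := by
    intro h; rw [h, norm_zero] at hyn
    exact absurd hyn.symm (ne_of_gt (by positivity : (0 : ℝ) < (3 : ℝ)⁻¹ ^ a))
  have hyQ0 : (y : ℚ_[3]) ≠ 0 := fun h ↦ hy0 (PadicInt.coe_eq_zero.1 h)
  refine ⟨27, (y : ℚ_[3]), ?_, by norm_num, hyQ0, ?_⟩
  · have h : ((y ^ 2 + ((81 * b + 3 ^ a * A₃ : ℤ) : ℤ_[3]) * y - 3 ^ 9 : ℤ_[3]) : ℚ_[3]) =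
        ((0 : ℤ_[3]) : ℚ_[3]) := congrArg _ hy
    have h3c : ((3 : ℤ_[3]) : ℚ_[3]) = 3 := by exact_mod_cast PadicInt.coe_natCast (p := 3) 3
    have h81 : ((81 : ℤ_[3]) : ℚ_[3]) = 81 := by exact_mod_cast PadicInt.coe_natCast (p := 3) 81
    push_cast at h
    try rw [h3c] at h
    try rw [h81] at h
    simp only [OnNF]
    linear_combination h
  · -- `v(y) = a`, `a ∈ {1,2}` is not a multiple of `3`
    have hv : (y : ℚ_[3]).valuation = a := by
      have hn : ‖(y : ℚ_[3])‖ = (3 : ℝ) ^ (-(a : ℤ)) := by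
        rw [← PadicInt.norm_def, hyn, inv_pow, ← zpow_natCast, ← zpow_neg]
      rw [Padic.norm_eq_zpow_neg_valuation hyQ0] at hn
      have := zpow_right_injective₀ (by norm_num : (0 : ℝ) < 3) (by norm_num : (3 : ℝ) ≠ 1) hn
      omega
    rw [hv]; rcases ha with rfl | rfl <;> decide

/-! ## §2 A UNIT class when `9 ∤ 3b + 3ᵃA₃` -/

/-- **Hensel, unit point.** For `c ∈ ℤ` with `3 ∣ c`, `9 ∤ c`: `Y² + cY − 1` has a root `y ∈ ℤ₃` which is a unit
and NOT a cube in `ℚ₃` (`ȳ² = 1 − c̄ȳ ≠ 1` in `ℤ/9`). [folklore] -/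
theorem exists_root_unit_not_cube (c : ℤ) (h3 : (3 : ℤ) ∣ c) (h9 : ¬ (9 : ℤ) ∣ c) :
    ∃ y : ℤ_[3], y ^ 2 + (c : ℤ_[3]) * y - 1 = 0 ∧ ‖y‖ = 1 ∧ ¬ ∃ w : ℚ_[3], (y : ℚ_[3]) = w ^ 3 := by
  have hc1 : ‖(c : ℤ_[3])‖ < 1 := (PadicInt.norm_int_lt_one_iff_dvd c).2 (by exact_mod_cast h3)
  let G : ℤ_[3][X] := X ^ 2 + C (c : ℤ_[3]) * X - 1
  have hG : ∀ t : ℤ_[3], aeval t G = t ^ 2 + (c : ℤ_[3]) * t - 1 := fun t ↦ by simp [G]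
  have hG' : ∀ t : ℤ_[3], aeval t (derivative G) = 2 * t + (c : ℤ_[3]) := fun t ↦ by
    simp [G, derivative_mul]
    try ring
    try norm_num
    try simp
  have h2 : ‖(2 : ℤ_[3])‖ = 1 := by exact_mod_cast norm_intCast_eq_one'' (n := 2) (by decide)
  have hn1 : ‖aeval (1 : ℤ_[3]) (derivative G)‖ = 1 := by
    rw [hG', mul_one, PadicInt.norm_add_eq_max_of_ne (by rw [h2]; exact ne_of_gt hc1), h2, max_eq_left hc1.le]
  have hn0 : ‖aeval (1 : ℤ_[3]) G‖ < 1 := by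
    rw [hG, show (1 : ℤ_[3]) ^ 2 + (c : ℤ_[3]) * 1 - 1 = c by ring]; exact hc1
  have hnorm : ‖aeval (1 : ℤ_[3]) G‖ < ‖aeval (1 : ℤ_[3]) (derivative G)‖ ^ 2 := by
    rw [hn1, one_pow]; exact hn0
  obtain ⟨y, hy, hy1, -, -⟩ := hensels_lemma hnorm
  rw [hG] at hy
  rw [hn1] at hy1
  have hyn : ‖y‖ = 1 := by
    have e : y = (y - 1) + 1 := by ring
    rw [e, PadicInt.norm_add_eq_max_of_ne (by rw [norm_one]; exact ne_of_lt hy1), norm_one,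
      max_eq_right hy1.le]
  refine ⟨y, hy, hyn, ?_⟩
  -- residues mod 9: `ȳ² + c̄ȳ - 1 = 0`, `ȳ` a unit, `c̄ ≠ 0` (as `9 ∤ c`) ⇒ `ȳ² ≠ 1`
  have hres : (PadicInt.toZModPow 2 y) ^ 2 ≠ 1 := by
    intro hsq
    have h := congrArg (PadicInt.toZModPow 2) hy
    simp only [map_sub, map_add, map_mul, map_pow, map_one, map_zero, map_intCast] at h
    obtain ⟨y', hy'⟩ := (PadicInt.isUnit_iff.mpr hyn).exists_right_inv
    have hu : PadicInt.toZModPow 2 y * PadicInt.toZModPow 2 y' = 1 := by rw [← map_mul, hy', map_one]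
    -- `c̄ ȳ = 0`, hence `c̄ = 0`
    have hc0 : ((c : ℤ) : ZMod (3 ^ 2)) = 0 := by
      have e1 : ((c : ℤ) : ZMod (3 ^ 2)) * PadicInt.toZModPow 2 y = 0 := by
        linear_combination h - hsq
      calc ((c : ℤ) : ZMod (3 ^ 2)) = ((c : ℤ) : ZMod (3 ^ 2)) * (PadicInt.toZModPow 2 y * PadicInt.toZModPow 2 y') := by
            rw [hu, mul_one]
        _ = 0 := by rw [← mul_assoc, e1, zero_mul]
    have : ((9 : ℕ) : ℤ) ∣ c := (ZMod.intCast_zmod_eq_zero_iff_dvd c (3 ^ 2)).1 hc0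
    exact h9 (by exact_mod_cast this)
  exact ThreeTorsionNormalForm.not_exists_pow_three_eq_of_sq_ne_one hyn hres

/-- **A UNIT class in Case S when `9 ∤ 3b + 3ᵃA₃`** (`a ∈ {1,2}`; no normalisation of `A₃` needed): the point
`(1, y)`. [cite: CohenPazuki2009ThreeDescent, Def. 1.3 and Prop. 2.2 (arXiv:0903.4963 pp. 4–5)] -/
theorem nfKummerHasUnit_S (a : ℕ) (b A₃ : ℤ) (ha : a = 1 ∨ a = 2)
    (h9 : ¬ (9 : ℤ) ∣ 3 * b + 3 ^ a * A₃) : NFKummerHasUnit b A₃ a := by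
  have h3 : (3 : ℤ) ∣ 3 * b + 3 ^ a * A₃ := by
    rcases ha with rfl | rfl
    · exact ⟨b + A₃, by ring⟩
    · exact ⟨b + 3 * A₃, by ring⟩
  obtain ⟨y, hy, hyn, hync⟩ := exists_root_unit_not_cube (3 * b + 3 ^ a * A₃) h3 h9
  refine ⟨1, (y : ℚ_[3]), ?_, one_ne_zero, ?_, hync⟩
  · have h : ((y ^ 2 + ((3 * b + 3 ^ a * A₃ : ℤ) : ℤ_[3]) * y - 1 : ℤ_[3]) : ℚ_[3]) = ((0 : ℤ_[3]) : ℚ_[3]) :=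
      congrArg _ hy
    have h3c : ((3 : ℤ_[3]) : ℚ_[3]) = 3 := by exact_mod_cast PadicInt.coe_natCast (p := 3) 3
    push_cast at h
    try rw [h3c] at h
    simp only [OnNF]
    linear_combination h
  · exact ⟨0, by
      rw [(ThreeTorsionNormalForm.norm_eq_one_iff.mp (by rw [← PadicInt.norm_def]; exact hyn)).2]; ring⟩

/-- **Third conjunct of the repaired node `C′`** (planner's normalisation `A₃ ≡ 1 (mod 3)`): `(cellS a b).k = 2 ⟹
NFKummerHasUnit b A₃ a`. [folklore] -/
theorem nfKummerHasUnit_S_of_cellS (a : ℕ) (b A₃ : ℤ) (ha : a = 1 ∨ a = 2) (hA : A₃ % 3 = 1)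
    (hk : (cellS a b).k = 2) : NFKummerHasUnit b A₃ a := by
  apply nfKummerHasUnit_S a b A₃ ha
  rcases ha with rfl | rfl
  · -- `k = 2` iff `b % 3 ≠ 2`; `9 ∣ 3b + 3A₃` iff `3 ∣ b + A₃` iff `b ≡ 2`
    have hb : b % 3 ≠ 2 := by
      intro hb; unfold cellS at hk; simp [hb] at hk
    omega
  · have hb : b % 3 ≠ 0 := by
      intro hb; unfold cellS at hk; simp [hb] at hk
    omega

end Summit.BirchSwinnertonDyer.Rank1Residual.O5.FlexNormalForm
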